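/-
Copyright (c) 2026. All rights reserved.
Released under Apache 2.0 license as described in the file LICENSE.
Authors: abc-iut cell, prover seat abc-iut-L4-d1 (gen 7; abc-iut-L4-lead m146 «GO L4-d1 ALPHA-ANALYTIC»: the punctured
cell's closer made UNCONDITIONAL by the proof of the named fact `PuncturedCompactRiemannSurfaceFreePi1`).
-/
import Literature.AnabelianGeometry.AbsoluteAnabelian.ArchimedeanHolFieldFunctorGeometricPSLPuncturedGenuineAlpha
import Literature.AlgebraicTopology.FundamentalGroup.PuncturedCompactRiemannSurfaceFreePi1Holds
import HarnessLib

/-!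
# [AbsTopIII] Prop 4.2 (i) / Cor 4.5 at every non-compact Riemann surface of finite type — UNCONDITIONAL (PROOF-ONLY)

S. Mochizuki, *Topics in Absolute Anabelian Geometry III*, proof of Prop 4.2 (i) p.106, Cor 4.5 pp.107–109
[MochizukiAbsTopIII2015]; W. S. Massey, *Algebraic Topology: An Introduction*, Ch. 4 §5 [Massey1967AlgebraicTopology].

abc-iut-w5-d096's `ArchimedeanHolFieldFunctorGeometricPSLPuncturedGenuineAlpha` proved Prop 4.2 (i) id-rigidity of
«objects of `EA` mapping to `X`» and `Cor_4_5_full` at every non-compact connected Riemann surface `X` of finite type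
with non-abelian `π₁`, CONDITIONALLY on the named classical fact (α) `PuncturedCompactRiemannSurfaceFreePi1` («`π₁` of a
punctured compact Riemann surface is free of finite rank»).  That fact is now a THEOREM of the tree —
`puncturedCompactRiemannSurfaceFreePi1_holds` (analytic route: a meromorphic function exhibits a cofinite open subset
as a finite covering of the plane minus finitely many points; puncture independence by van Kampen) — so the binder
`(H : PuncturedCompactRiemannSurfaceFreePi1)` is discharged BY NAME:

* `HolRS.isFreeOfFiniteRank_fundamentalGroup_of_isOfFiniteType'` — `π₁(X, x₀)` is free of finite rank for every
  non-compact `X` of finite type, NO hypothesis;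
* ★ `HolRS.isIdRigid_EA_and_cor_4_5_full_mapsTo_of_isOfFiniteType_unconditional` (+ RC twin) — Prop 4.2 (i) ∧
  `Cor_4_5_full` at EVERY non-compact connected Riemann surface of finite type with non-abelian `π₁`; hypotheses
  {finite type, non-compact, `π₁` non-abelian} only (classically the last excludes exactly `ℂ` and `ℂ^×`; that
  equivalence is not proved here).

PROOF-ONLY: no definition, no instance, no named fact.  HONEST FRAMING: classical; MODEL side of [AbsTopIII] §4 (the
geometric column), not a reconstruction statement; nothing here bears on the disputed [IUTchIII] Cor. 3.12.
-/

set_option autoImplicit false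

noncomputable section

namespace Literature.AnabelianGeometry.AbsoluteAnabelian

namespace HolRS

open scoped _root_.Manifold _root_.ContDiff _root_.Topology
open _root_.Function _root_.CategoryTheory _root_.TopologicalSpace _root_.Set
open Literature.IUT.HodgeTheaters (IsFreeOrSurface IsFreeOfFiniteRank)
open Literature.AlgebraicTopology.FundamentalGroup (PuncturedCompactRiemannSurfaceFreePi1
  puncturedCompactRiemannSurfaceFreePi1_holds)

variable (X : HolRS)

/-- **(α) at every non-compact Riemann surface of finite type, UNCONDITIONALLY**: the fundamental group of a
non-compact connected Riemann surface of finite type is free of finite rank (the named fact, now the theorem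
`puncturedCompactRiemannSurfaceFreePi1_holds`, transported along the finite-type witness).
[cite: Massey1967AlgebraicTopology, Ch. 4 §5] [cite: MochizukiAbsTopIII2015, Corollary 2.4 p.54] -/
theorem isFreeOfFiniteRank_fundamentalGroup_of_isOfFiniteType' (hX : IsOfFiniteType X.carrier)
    (hnc : ¬ CompactSpace X.carrier) (x₀ : X.carrier) : IsFreeOfFiniteRank (FundamentalGroup X.carrier x₀) :=
  X.isFreeOfFiniteRank_fundamentalGroup_of_isOfFiniteType puncturedCompactRiemannSurfaceFreePi1_holds hX hnc x₀

/-- ★ **[AbsTopIII] Prop 4.2 (i) id-rigidity + `Cor_4_5_full` at EVERY non-compact connected Riemann surface of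
finite type with non-abelian `π₁` — NO named-fact hypothesis** (holomorphic morphisms).
[cite: MochizukiAbsTopIII2015, Proposition 4.2 (i) proof p.106] [cite: MochizukiAbsTopIII2015, Corollary 4.5 pp.107–109]
[cite: Massey1967AlgebraicTopology, Ch. 4 §5] -/
theorem isIdRigid_EA_and_cor_4_5_full_mapsTo_of_isOfFiniteType_unconditional (hX : IsOfFiniteType X.carrier)
    (hnc : ¬ CompactSpace X.carrier) (x₀ : X.carrier)
    (hab : ∃ a b : FundamentalGroup X.carrier x₀, a * b ≠ b * a) :
    IsIdRigid (geometricAutHolFieldFunctor fun Y : HolRS => Nonempty (Y ⟶ X)).EA ∧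
      AbsTopIII.Cor_4_5_full
        (archLogFrobeniusData (geometricAutHolFieldFunctor fun Y : HolRS => Nonempty (Y ⟶ X)))
        (archTelecoreData (geometricAutHolFieldFunctor fun Y : HolRS => Nonempty (Y ⟶ X))) :=
  X.isIdRigid_EA_and_cor_4_5_full_mapsTo_of_isOfFiniteType_of_freePi1
    puncturedCompactRiemannSurfaceFreePi1_holds hX hnc x₀ hab

/-- ★ **The same for print's RC-holomorphic morphisms**, NO named-fact hypothesis.
[cite: MochizukiAbsTopIII2015, Proposition 4.2 (i) proof p.106] [cite: Massey1967AlgebraicTopology, Ch. 4 §5] -/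
theorem RC.isIdRigid_EA_and_cor_4_5_full_mapsTo_of_isOfFiniteType_unconditional (hX : IsOfFiniteType X.carrier)
    (hnc : ¬ CompactSpace X.carrier) (x₀ : X.carrier)
    (hab : ∃ a b : FundamentalGroup X.carrier x₀, a * b ≠ b * a) :
    IsIdRigid (geometricAutHolFieldFunctorRC fun Y : RC => Nonempty (Y ⟶ toRC.obj X)).EA ∧
      AbsTopIII.Cor_4_5_full
        (archLogFrobeniusData (geometricAutHolFieldFunctorRC fun Y : RC => Nonempty (Y ⟶ toRC.obj X)))
        (archTelecoreData (geometricAutHolFieldFunctorRC fun Y : RC => Nonempty (Y ⟶ toRC.obj X))) :=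
  RC.isIdRigid_EA_and_cor_4_5_full_mapsTo_of_isOfFiniteType_of_freePi1 X
    puncturedCompactRiemannSurfaceFreePi1_holds hX hnc x₀ hab

end HolRS

end Literature.AnabelianGeometry.AbsoluteAnabelian

end
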